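import Summits.QuantumFields.BalabanUV.Beta.FP.MixLoopInstanceBlockFamilyGamma
import Summits.QuantumFields.BalabanUV.Beta.FP.MixLoopPowerCountingMassCubic

/-!
# `Beta/FP/MixLoopInstanceBlockFamilyCubic` — road «FP» (binder row D1), row **RHOA-6e (INST-MIX3)** «THE MIX-3 ENGINE AT THE ROOTED BLOCK FAMILY AND THE
# LATTICE COLUMNS»: RHOA-6c′'s mass-currency (MIX-3) engine `MixLoopPowerCountingMassCubic.coarse_mix3_secondMoment_le` (`−2·tr(Q̇·Γ₀·Ḣ·𝓘)`) INSTANTIATED with the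
# first-jet majorant kernel `ker₁ (blkW N p) (blkFld N μ u) (blkBg N μ u rad id)` of RHOA-6b′'s rooted block families, the insertion-side letter (M) of
# `MixLoopInstanceBlockFamily.windowedMass_blk_le`, and the reference∕running legs `J` AND the interpolation sup (I₀) pinned to the perfect lattice columns
# `N⁴ • colOf (KPerf …)`; the fine covariance `Γ` and the cubic vertex `H` stay ABSTRACT under the engine's displayed letters (their instances at the perfect data
# are IR-2's ∕ GAMMA's ∕ the owner's LEDGER) — every power of `N = Lc^m` DISPLAYED ([folklore] index plumbing on `ℤ⁴`; no road object identified)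

HONEST FRAMING (cell `pub-balaban`, β sub-cell, verbatim): discharging `BetaPertH` makes Bałaban's UV stability UNCONDITIONAL — a real constructive-QFT
result; it is NOT the continuum limit and NOT the Clay problem.  THIS MODULE is [folklore] finite-sum plumbing composed BY NAME with ACCEPTED road theorems:
`MixLoopPowerCountingMassCubic.coarse_mix3_secondMoment_le` (t4-ne7b-formalise-leaf-01-g23, RHOA-6c′), `MixLoopInstanceBlockFamily.{blk_ker₁_fld_local, windowedMass_blk_le}`
(p247290), `MixLoopInstanceBlockFamilyGamma.latticeColumn_letterJ_of_le`.  It asserts nothing about Bałaban's objects, cites nothing, mints no `Prop` fact, has no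
`def`, 0 sorry.  NOT `Mix_n = O(1)` (the instance number `Σ_σ p σ ≲ N` is KER-γ (γ)'s; `C_Γ`, `C′_Γ`, `C_H` in lattice units are IR-2's∕GAMMA's; the four-direction sum and
the (rem)-piece packaging are the owner's LEDGER), NOT hbook, NOT D1, NOT BetaPertH, NOT continuum, NOT Clay.
HONEST DEPENDENCY: continuum YM on T⁴ ⇐ BetaPertH ∧ nine spine estimates (0/9 proved); BetaPertH ⇐ (D1) ∧ (D4) ∧ CAP+tail; G-an2-4 gates asym, D1 and NE2/3/4.

ABSOLUTE RULE (cell charter, verbatim): «No internally-minted statement may enter as a cited fact. Every hypothesis is either kernel-proved in this package or a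
verbatim quotation of a PUBLISHED theorem with page reference. The manuscript(s) under audit are NOT citable for their own disputed steps — they are the thing under
adjudication; programme-internal (2001/route/tribunal) claims are never citable.»

CURRENCY: as in `MixLoopInstanceBlockFamily` (labels = points, `strB = id`; `rad`, `p`, `ℓ₀`, `R₀ ≥ 2` FREE with their displayed letters).  The (MIX-3) engine carries
ONE averaging jet, NO coarse-radius letter and the offset letter (W): so `U b` is ARBITRARY as given and `W` is freed by the support (`blk_ker₁_fld_local`).
CONTENT.  §1 `loopKernel₃_eq_filter` (far offsets vanish in the one-jet kernel shape) and **`coarse_mix3_secondMoment_blk_free`** = the engine BY NAME at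
`qd := ker₁ (blkW N p) (blkFld N μ u) (blkBg N μ u rad id)`, radius multiplier `R := R₀ + 2`, (M) := `windowedMass_blk_le` (centre `N•v₀`), ARBITRARY `U`, every finite
`W`, legs `J` abstract under (J)(J′), the cubic leg's letters (I₀)(Γ₀)(Γ₁)(H)(H₀) EXACTLY the engine's: bound `3·C_J·C_J′·(1+16∕δ²)·((C_I·(C_H·Zl 4 δ_H))·Ψ·A_M)` with
the engine's `Ψ(δ, δ_H, C_Γ, C′_Γ, R₀+2, N)` VERBATIM (its explicit `·N` term displayed) and `A_M = ((ℓ₀+N)·Σp)·e^{δR₀∕2}·(e^{δ∕2}(1+480e^{δ∕4}(4∕δ)⁴))`.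
§2 END **`mix3_rem_blockFamily`**: `J := N⁴ • colOf (KPerf Lc (sfStep Lc) (smStep 3 Lc) m)` at any profile rate `δ ∈ (0, κ₀∕4]` (`C_J = C·N⁻¹`, `C_J′ = C·N⁻¹·A(κ₀)`) and
the interpolation sup (I₀) pinned too — `I x′ u := J_m κI lI (N•u − x′)`, `C_I = C·N⁻¹` (the (J) letter with `e^{−…} ≤ 1`): `≤ 3·(C·N⁻¹)·(C·N⁻¹·A(κ₀))·(1+16∕δ²)·(((C·N⁻¹)·(C_H·Zl 4 δ_H))·Ψ·A_M)`
— every power of `N` displayed: `N⁻³·Ψ·((ℓ₀+N)·Σp)·C_H` × m-free numbers, `Ψ = C′_Γ·(…)·N + C_Γ·(…)`.  `∃ κ₀ C` BEFORE `∀ δ`, `∀ δ_H`, `∀ m` and the block data.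
NOT TYPED HERE: the identification with the road's (MIX-3) term (KER-γ (α)), `Γ = Γ₀`, `H = Ḣ` at the perfect data, MIX-4 (leaf-01-g24's offer), the (rem) packaging.
Provenance: cross-cell idle-seat kernel duty NE7b → β∕D1, unit `b2b-balaban-t4-ne7b-formalise-leaf-02` gen 23 (prover-…-leaf-02-g23-0), 2026-08-21, INTENT O-ne7bleaf02g23-2
(journal l.27031) on the owner's «(MIX-3) open» (l.26879) under R-FP-33 (c); «not in print; our bookkeeping»; no existing file touched.
-/

noncomputable section

namespace Summit.QuantumFields.BalabanUV.Beta.FP.MixLoopInstanceBlockFamilyCubic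

open Finset Real
open scoped BigOperators
open Literature.MathematicalPhysics.QuantumFieldTheory.Balaban1983to89
open Literature.MathematicalPhysics.QuantumFieldTheory.Balaban1983to89.Beta
open B12Sec2to5 (l1)
open ExpKernelCalculus (Zl)
open DyadicShell (Pt supNorm)
open AxialBlockWeights (idx)
open Summit.QuantumFields.BalabanUV.Beta.GAN24.CombesThomas (sfStep smStep)
open Summit.QuantumFields.BalabanUV.Beta.FP.PerfectObjectsT (KPerf)
open Summit.QuantumFields.BalabanUV.Beta.FP.TransportInfinityM (colOf)
open Summit.QuantumFields.BalabanUV.Beta.FP.AveragingJetLettersRooted (ker₁ blkW blkFld blkBg)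
open Summit.QuantumFields.BalabanUV.Beta.FP.MixLoopPowerCounting (supNorm_cast_nonneg)
open Summit.QuantumFields.BalabanUV.Beta.FP.MixLoopPowerCountingMassCubic (coarse_mix3_secondMoment_le)
open Summit.QuantumFields.BalabanUV.Beta.FP.MixLoopInstanceBlockFamily (blk_ker₁_fld_local windowedMass_blk_le)
open Summit.QuantumFields.BalabanUV.Beta.FP.MixLoopInstanceBlockFamilyGamma (latticeColumn_letterJ_of_le)

/-! ## §1 Free offset window and the engine at the block family, abstract legs -/

/-- [folklore] **FAR OFFSETS VANISH IN THE ONE-JET KERNEL**: if `q u b (b + w)` vanishes unless `PW w`, then for every coarse window and every finite `W`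
`Σ_{u∈U b}Σ_{w∈W} q u b (b+w)·F u (b+w) b′` equals the same sum over `W.filter PW` (`Finset.sum_filter_of_ne`). -/
theorem loopKernel₃_eq_filter {q : Pt → Pt → Pt → ℝ} (F : Pt → Pt → Pt → ℝ) (PW : Pt → Prop) [DecidablePred PW]
    (hzW : ∀ u b w, ¬ PW w → q u b (b + w) = 0) (U : Pt → Finset Pt) (W : Finset Pt) (b b' : Pt) :
    (∑ u ∈ U b, ∑ w ∈ W, q u b (b + w) * F u (b + w) b') = ∑ u ∈ U b, ∑ w ∈ W.filter PW, q u b (b + w) * F u (b + w) b' := by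
  refine Finset.sum_congr rfl fun u _ => ?_
  symm
  rw [Finset.sum_filter_of_ne]
  intro w _ hne
  by_contra hfar
  exact hne (by rw [hzW u b w hfar, zero_mul])

section Block

variable {σ : Type*} [Fintype σ] {N : ℕ} {μ : Fin 4} {p : σ → ℝ} {rad : σ → Pt → Pt → List Pt} {ℓ₀ R₀ : ℕ}

/-- **THE (MIX-3) ENGINE AT THE ROOTED BLOCK FAMILY, FREE OFFSET WINDOW, ABSTRACT LEGS** ([folklore] plumbing; `coarse_mix3_secondMoment_le` BY NAME at
`qd u b c := ker₁ (blkW N p) (blkFld N μ u) (blkBg N μ u rad id) b c`, radius multiplier `R := R₀ + 2`, (M) := `windowedMass_blk_le` at the centre `N•v₀`): for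
ARBITRARY coarse windows `U b` and EVERY finite offset window `W` (far offsets vanish, `blk_ker₁_fld_local`), under the cubic leg's letters (I₀)(Γ₀)(Γ₁)(H)(H₀) and
the legs' (J)(J′) EXACTLY as the engine displays them:
`Σ_{v∈V}‖v−v₀‖∞²·|Σ_{b,b′∈S} J b v₀·J b′ v·k₃(b,b′)| ≤ 3·C_J·C_J′·(1+16∕δ²)·((C_I·(C_H·Zl 4 δ_H))·Ψ·A_M)` with the engine's `Ψ` at `R = R₀ + 2`, `n = N` VERBATIM and
`A_M = ((ℓ₀+N)·Σp)·e^{δR₀∕2}·(e^{δ∕2}(1+480e^{δ∕4}(4∕δ)⁴))`. -/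
theorem coarse_mix3_secondMoment_blk_free {δ δH : ℝ} (hδ : 0 < δ) (hδH : 0 < δH) (hN : 1 ≤ N) (μ : Fin 4) (hp : ∀ s, 0 ≤ p s)
    (hrad : ∀ s u x', (rad s u x').length ≤ ℓ₀) (hR₀ : 2 ≤ R₀)
    (hradR : ∀ (s : σ) (u : Pt) (q : ↥(idx N)) (ℓ : Pt), ℓ ∈ rad s u q.1.1 → supNorm (ℓ - (N : ℤ) • u) ≤ R₀ * N)
    (U : Pt → Finset Pt) (W : Finset Pt) {I Γ J : Pt → Pt → ℝ} {H : Pt → Pt → Pt → ℝ} {C_I C_Γ C_Γ' C_H C_J C_J' : ℝ}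
    (hI0 : ∀ x' u, |I x' u| ≤ C_I) (hΓ0 : ∀ c x, |Γ c x| ≤ C_Γ)
    (hΓ1 : ∀ c t (i : Fin 4), |Γ c (t + Pi.single i 1) - Γ c t|
      ≤ C_Γ' / ((supNorm (c - t) : ℝ) + 1) ^ 3 * Real.exp (-(δ / N) * (supNorm (c - t) : ℝ)))
    (hH : ∀ b' x x', |H b' x x'| ≤ C_H * Real.exp (-δH * l1 (x - b')) * Real.exp (-δH * l1 (x' - b')))
    (hH0 : ∀ b' x', ∑' x, H b' x x' = 0) (S V : Finset Pt) (v₀ : Pt)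
    (hJ : ∀ b, |J b v₀| ≤ C_J * Real.exp (-(δ / N) * (supNorm (b - (N : ℤ) • v₀) : ℝ)))
    (hJ' : ∀ b', ∑ v ∈ V, (1 + ((supNorm (b' - (N : ℤ) • v) : ℝ) / N) ^ 2) * |J b' v| ≤ C_J') :
    ∑ v ∈ V, (supNorm (v - v₀) : ℝ) ^ 2 *
        |∑ b ∈ S, ∑ b' ∈ S, J b v₀ * J b' v *
          (∑ u ∈ U b, ∑ w ∈ W, ker₁ (blkW N p) (blkFld N μ u) (blkBg N μ u rad id) b (b + w) *
            ∑' x', I x' u * ∑' x, Γ (b + w) x * H b' x x')|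
      ≤ 3 * C_J * C_J' * (1 + 16 / δ ^ 2) *
        ((C_I * (C_H * Zl 4 δH)) *
          ((256 / 27 * C_Γ' * (Real.exp (δH / 2) * (2 / δH) * Zl 4 (δH / 2)))
              * ((1 + 2 * ((R₀ : ℝ) + 2) ^ 2) * (1 + 80 * Real.exp ((3 * δ / 4) / 2) * (2 / (3 * δ / 4)))
                + 2 * (1 + 160 * Real.exp ((3 * δ / 4) / 2) * (2 / (3 * δ / 4)) ^ 3)) * N
            + (2 * C_Γ * 20 ^ 8 * (40320 * Real.exp (δH / 2) * (2 / δH) ^ 8 * Zl 4 (δH / 2))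
                + (8 * C_Γ * (Real.exp (δH / 2) * (2 / δH) * Zl 4 (δH / 2)) + 2 * C_Γ * (Real.exp (δH / 2) * Zl 4 (δH / 2))) * 5 ^ 8)
              * 81 * (3 + 2 * ((R₀ : ℝ) + 2) ^ 2)) *
          ((((ℓ₀ + N : ℕ) : ℝ) * ∑ s, p s) * Real.exp (δ * R₀ / 2) *
            (Real.exp (δ / 2) * (1 + 480 * Real.exp (δ / 4) * (4 / δ) ^ 4)))) := by
  classical
  have hzW : ∀ u b w, ¬ supNorm w ≤ (R₀ + 2) * N →
      ker₁ (blkW N p) (blkFld N μ u) (blkBg N μ u rad id) b (b + w) = 0 := by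
    intro u b w hfar
    by_contra hne
    have h := blk_ker₁_fld_local hR₀ hradR hne
    rw [add_sub_cancel_left] at h
    exact hfar h
  have hWr : ∀ w ∈ W.filter (fun w => supNorm w ≤ (R₀ + 2) * N), supNorm w ≤ (R₀ + 2) * N :=
    fun w hw => (Finset.mem_filter.mp hw).2
  have hA := coarse_mix3_secondMoment_le
    (qd := fun u b c => ker₁ (blkW N p) (blkFld N μ u) (blkBg N μ u rad id) b c) (R := R₀ + 2) (U := U)
    hδ hδH hN hWr hI0 hΓ0 hΓ1 hH hH0 S V v₀ hJ hJ'
    (windowedMass_blk_le hδ hN μ hp hrad hR₀ hradR U (W.filter (fun w => supNorm w ≤ (R₀ + 2) * N)) S ((N : ℤ) • v₀))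
  have e : (((R₀ + 2 : ℕ) : ℝ)) = (R₀ : ℝ) + 2 := by push_cast; ring
  rw [e] at hA
  have hker := fun b b' => loopKernel₃_eq_filter (q := fun u b c => ker₁ (blkW N p) (blkFld N μ u) (blkBg N μ u rad id) b c)
    (fun u c b' => ∑' x', I x' u * ∑' x, Γ c x * H b' x x') (fun w => supNorm w ≤ (R₀ + 2) * N) hzW U W b b'
  simp only [hker]
  exact hA

end Block

/-! ## §2 The END -/

section Columns

variable {Lc : ℕ} [NeZero Lc]

/-- **THE END `mix3_rem_blockFamily` — ROW RHOA-6e (INST-MIX3)** ([our object]; `d = 3`, `2 ≤ Lc`): there are `κ₀ > 0` and `C ≥ 0` (the perfect columns' letters) such that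
for EVERY profile rate `δ ∈ (0, κ₀∕4]`, every vertex rate `δ_H > 0` and EVERY `m ≥ 1`, with `N = Lc^m` and `J_m = N⁴ • colOf (KPerf Lc (sfStep Lc) (smStep 3 Lc) m)`, for
every coarse direction `μ`, leg index pairs `(κI,lI)`, `(κJ,lJ)`, every rooted block family at blocking `N` (rules `σ`, probabilities `p σ ≥ 0`, radial words of length `≤ ℓ₀`
within `R₀·N` of the anchor, `2 ≤ R₀`), ARBITRARY coarse windows `U b`, every finite offset window `W`, every fine covariance `Γ` with (Γ₀) `|Γ c x| ≤ C_Γ` and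
(Γ₁) `|Γ c (t+e_i) − Γ c t| ≤ C′_Γ(‖c−t‖∞+1)⁻³e^{−(δ∕N)‖c−t‖∞}`, every cubic vertex `H` with (H) `|H b′ x x′| ≤ C_H e^{−δ_H(|x−b′|₁+|x′−b′|₁)}` and (H₀) `∑'_x H b′ x x′ = 0`,
all finite `S`, `V` and every `v₀` — with the interpolation `I x′ u := J_m κI lI (N•u − x′)` (sup `C·N⁻¹`) and the legs `J b v := J_m κJ lJ (N•v − b)`:
`Σ_{v∈V}‖v−v₀‖∞²·|Σ_{b,b′∈S} J b v₀·J b′ v·Σ_{u∈U b}Σ_{w∈W} ker₁^{(u)} b (b+w)·∑'_{x′} I x′ u·∑'_x Γ (b+w) x·H b′ x x′|`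
`≤ 3·(C·N⁻¹)·(C·N⁻¹·A(κ₀))·(1+16∕δ²)·(((C·N⁻¹)·(C_H·Zl 4 δ_H))·Ψ(δ, δ_H, C_Γ, C′_Γ, R₀+2, N)·A_M)` — EVERY power of `N` displayed (`N⁻³·Ψ·((ℓ₀+N)·Σp)` × m-free,
`Ψ`'s own `·N` term as the engine prints it).  NOT the identification with the road's (MIX-3) term, NOT `Γ = Γ₀`∕`H = Ḣ` at the perfect data, NOT the
four-direction sum, NOT `Mix_n = O(1)`, NOT hbook, NOT D1, NOT BetaPertH. -/
theorem mix3_rem_blockFamily (hLc : 2 ≤ Lc) :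
    ∃ κ₀ C : ℝ, 0 < κ₀ ∧ 0 ≤ C ∧ ∀ δ : ℝ, 0 < δ → δ ≤ κ₀ / 4 → ∀ δH : ℝ, 0 < δH → ∀ m : ℕ, 1 ≤ m →
      ∀ {σ : Type*} [Fintype σ] (μ κI lI κJ lJ : Fin 4) {p : σ → ℝ} (_ : ∀ s, 0 ≤ p s)
        {rad : σ → Pt → Pt → List Pt} {ℓ₀ R₀ : ℕ} (_ : ∀ s u x', (rad s u x').length ≤ ℓ₀) (_ : 2 ≤ R₀)
        (_ : ∀ (s : σ) (u : Pt) (q : ↥(idx (Lc ^ m))) (ℓ : Pt), ℓ ∈ rad s u q.1.1 →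
          supNorm (ℓ - ((Lc ^ m : ℕ) : ℤ) • u) ≤ R₀ * Lc ^ m)
        (U : Pt → Finset Pt) (W : Finset Pt) {Γ : Pt → Pt → ℝ} {H : Pt → Pt → Pt → ℝ} {C_Γ C_Γ' C_H : ℝ}
        (_ : ∀ c x, |Γ c x| ≤ C_Γ)
        (_ : ∀ c t (i : Fin 4), |Γ c (t + Pi.single i 1) - Γ c t|
          ≤ C_Γ' / ((supNorm (c - t) : ℝ) + 1) ^ 3 * Real.exp (-(δ / ((Lc ^ m : ℕ) : ℝ)) * (supNorm (c - t) : ℝ)))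
        (_ : ∀ b' x x', |H b' x x'| ≤ C_H * Real.exp (-δH * l1 (x - b')) * Real.exp (-δH * l1 (x' - b')))
        (_ : ∀ b' x', ∑' x, H b' x x' = 0) (S V : Finset Pt) (v₀ : Pt),
        ∑ v ∈ V, (supNorm (v - v₀) : ℝ) ^ 2 *
            |∑ b ∈ S, ∑ b' ∈ S,
              ((((Lc ^ m : ℕ) : ℝ) ^ 4) • colOf (KPerf (d := 3) Lc (sfStep Lc) (smStep 3 Lc) m)) κJ lJ (((Lc ^ m : ℕ) : ℤ) • v₀ - b) *
              ((((Lc ^ m : ℕ) : ℝ) ^ 4) • colOf (KPerf (d := 3) Lc (sfStep Lc) (smStep 3 Lc) m)) κJ lJ (((Lc ^ m : ℕ) : ℤ) • v - b') *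
              (∑ u ∈ U b, ∑ w ∈ W, ker₁ (blkW (Lc ^ m) p) (blkFld (Lc ^ m) μ u) (blkBg (Lc ^ m) μ u rad id) b (b + w) *
                ∑' x', ((((Lc ^ m : ℕ) : ℝ) ^ 4) • colOf (KPerf (d := 3) Lc (sfStep Lc) (smStep 3 Lc) m)) κI lI
                    (((Lc ^ m : ℕ) : ℤ) • u - x') *
                  ∑' x, Γ (b + w) x * H b' x x')|
          ≤ 3 * (C * (((Lc ^ m : ℕ) : ℝ))⁻¹)
              * (C * (((Lc ^ m : ℕ) : ℝ))⁻¹ * ((1 + 16 / (κ₀ / 4) ^ 2)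
                  * (Real.exp (κ₀ / 4 / 2) * (1 + 480 * Real.exp (κ₀ / 4 / 2 / 2) * (2 / (κ₀ / 4 / 2)) ^ 4))))
              * (1 + 16 / δ ^ 2) *
            ((C * (((Lc ^ m : ℕ) : ℝ))⁻¹ * (C_H * Zl 4 δH)) *
              ((256 / 27 * C_Γ' * (Real.exp (δH / 2) * (2 / δH) * Zl 4 (δH / 2)))
                  * ((1 + 2 * ((R₀ : ℝ) + 2) ^ 2) * (1 + 80 * Real.exp ((3 * δ / 4) / 2) * (2 / (3 * δ / 4)))
                    + 2 * (1 + 160 * Real.exp ((3 * δ / 4) / 2) * (2 / (3 * δ / 4)) ^ 3)) * ((Lc ^ m : ℕ) : ℝ)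
                + (2 * C_Γ * 20 ^ 8 * (40320 * Real.exp (δH / 2) * (2 / δH) ^ 8 * Zl 4 (δH / 2))
                    + (8 * C_Γ * (Real.exp (δH / 2) * (2 / δH) * Zl 4 (δH / 2)) + 2 * C_Γ * (Real.exp (δH / 2) * Zl 4 (δH / 2))) * 5 ^ 8)
                  * 81 * (3 + 2 * ((R₀ : ℝ) + 2) ^ 2)) *
              ((((ℓ₀ + Lc ^ m : ℕ) : ℝ) * ∑ s, p s) * Real.exp (δ * R₀ / 2) *
                (Real.exp (δ / 2) * (1 + 480 * Real.exp (δ / 4) * (4 / δ) ^ 4)))) := by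
  obtain ⟨κ₀, C, hκ₀, hC, h⟩ := latticeColumn_letterJ_of_le (Lc := Lc) hLc
  refine ⟨κ₀, C, hκ₀, hC, fun δ hδ hδκ δH hδH m hm σ _ μ κI lI κJ lJ p hp rad ℓ₀ R₀ hrad hR₀ hradR U W Γ H C_Γ C_Γ' C_H
    hΓ0 hΓ1 hH hH0 S V v₀ => ?_⟩
  have hN1 : 1 ≤ Lc ^ m := Nat.one_le_pow m Lc (le_trans (by norm_num) hLc)
  have hN : (0 : ℝ) < ((Lc ^ m : ℕ) : ℝ) := by exact_mod_cast hN1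
  -- (I₀): the columns' sup letter, from the (J) letter at rate `δ` with `e^{−…} ≤ 1`
  have hI0 : ∀ x' u : Pt,
      |((((Lc ^ m : ℕ) : ℝ) ^ 4) • colOf (KPerf (d := 3) Lc (sfStep Lc) (smStep 3 Lc) m)) κI lI (((Lc ^ m : ℕ) : ℤ) • u - x')|
        ≤ C * (((Lc ^ m : ℕ) : ℝ))⁻¹ := by
    intro x' u
    refine ((h δ hδκ m hm κI lI).1 x' u).trans (mul_le_of_le_one_right (by positivity) (Real.exp_le_one_iff.mpr ?_))
    have hx := supNorm_cast_nonneg (x' - ((Lc ^ m : ℕ) : ℤ) • u)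
    have : 0 ≤ δ / ((Lc ^ m : ℕ) : ℝ) * (supNorm (x' - ((Lc ^ m : ℕ) : ℤ) • u) : ℝ) := by positivity
    linarith
  exact coarse_mix3_secondMoment_blk_free (N := Lc ^ m) hδ hδH hN1 μ hp hrad hR₀ hradR U W
    (I := fun x' u => ((((Lc ^ m : ℕ) : ℝ) ^ 4) • colOf (KPerf (d := 3) Lc (sfStep Lc) (smStep 3 Lc) m)) κI lI
      (((Lc ^ m : ℕ) : ℤ) • u - x'))
    (J := fun b v => ((((Lc ^ m : ℕ) : ℝ) ^ 4) • colOf (KPerf (d := 3) Lc (sfStep Lc) (smStep 3 Lc) m)) κJ lJ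
      (((Lc ^ m : ℕ) : ℤ) • v - b))
    hI0 hΓ0 hΓ1 hH hH0 S V v₀ (fun b => (h δ hδκ m hm κJ lJ).1 b v₀) (fun b' => (h δ hδκ m hm κJ lJ).2 b' V)

end Columns

end Summit.QuantumFields.BalabanUV.Beta.FP.MixLoopInstanceBlockFamilyCubic

end
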